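import Summits.BirchSwinnertonDyer.BirchSwinnertonDyer.Theorems.EisensteinDepletionAtTwoStarGlueFinPointwise
import HarnessLib

/-!
# Route `EisensteinDepletionAtTwo`, crux E1M `DepletedLambdaLawAtTwoMod` (item stmt-BirchSwinnertonDyer-20341),
# line `star` — **(★-GlueFin): the FINITE-LEVEL glue** (curve side): a mod-2 cusp congruence in the `8`-normalisation
# plus the finite-level Eisenstein half (★-EisFin) force `X²·red(pfree L₀) = red(1+T)·red H`

Cell `bsd-rank2`, seat `bsd-rank2-eng-2` GEN 8. THEOREMS ONLY — no definition, no named fact, no `sorry`. HONEST FRAMING: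
`Λ`-bookkeeping and elementary `2`-adic estimates (the finite-level variant of the lead's `red_pfree_eq_of_cuspCongruence`,
p551400, proposed in evidence #39 on the item): the two halves of (★) enter as HYPOTHESES about an arbitrary function
`v : ℕ → ℤ → ℚ` — the cusp congruence `hC` ((★-SymbC′): on `C`, `([a/2^m]⁺_f − [1/2^m]⁺_f)/g ∈ ℤ` is congruent to `v(m,a)/8`
modulo `2ℤ₂`) and the smoothed Riemann-sum congruence `hH` (the output (i) of `starEisFin` for `v = stabEisCuspDiff N β`);
nothing here proves either, nothing reads an analytic rank, BSD is not proved by any of this (PARTITION D-0054: none — r_an ≥ 2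
axis S0, door T-r3₂). DIFFERENCE with p551400: no `2`-adic CONVERGENCE of the Eisenstein Riemann sums is assumed; instead BOTH
sides are smoothed by Stevens' `Sm_5^5` (lit's `stevensSmoothing 5`), whose transform on the bounded distribution `μ_f` is
`(26 − 5(1+T) − 5(1+T)⁻¹)·L₂(f, α)` (lit GEN 21, `distributionTransform_stevensSmoothing_five`) with
`red(26 − 5(1+T) − 5(1+T)⁻¹) = X²·red((1+T)⁻¹)` — this is where the `T²` of (★) comes from.

* (§1–§2 pointwise lemmas: `…StarGlueFinPointwise.lean`.)
* **`sq_X_mul_red_pfree_eq_of_cuspCongruence8`**: `hC` + `hH` (`∀ k, ∀ᶠ n, ‖RS_k(Sm ν₈)(n) − [T^k]ιH‖ ≤ 2⁻¹`) + `red H ≠ 0`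
  ⇒ for every nonzero `L₀ ∈ Λ` with `ιL₀ = c·L₂(f, α)`: `X²·red(pfree L₀) = red((1+T))·red H`.
  (`g⁻¹RS(Sm μ_f) − 2RS(Sm ν₈) = 2ΣD_sC(s,k) + 32g⁻¹μ_f(1)C(2ⁿ,k+1)`; limit only on the curve side; `(2gc)⁻¹·Sm_Λ·L₀ = ιL₁`,
  `red L₁ = red H`; `pfree(Sm_Λ·L₀) = Sm_Λ·pfree L₀` (`pfree_mul_of_red_ne_zero`), primitive-scale transfer `red_pfree_eq_red_two`.)

References: B. Mazur, J. Tate, J. Teitelbaum, Invent. Math. 84 (1986), §I.10–I.13 [MazurTateTeitelbaum1986Invent]; G. Stevens,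
*Arithmetic on Modular Curves* (1982), §5.4 [Stevens1982]; R. Greenberg, V. Vatsal, Invent. Math. 142 (2000), §3 [GreenbergVatsal2000].
-/

set_option linter.dupNamespace false
set_option autoImplicit false

noncomputable section

open scoped Classical
open scoped MatrixGroups

open Filter Topology CongruenceSubgroup
  Literature.NumberTheory.EllipticCurves Literature.NumberTheory.EllipticCurves.ModularForms
  Summit.BirchSwinnertonDyer.Rank1Residual.X1.MuLambda

namespace Summit.BirchSwinnertonDyer.BirchSwinnertonDyer.Theorems.DepletionAtTwo

section GlueFin

variable {N : ℕ} [NeZero N] (f : CuspForm (Gamma0 N) 2) {W : WeierstrassCurve ℚ} [W.IsElliptic] [W.IsGloballyMinimal]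

/-- **(★-GlueFin), curve side.** Let `W/ℚ` be good ordinary at `2` with newform `f` and unit root `α`, `v : ℕ → ℤ → ℚ` any
function with `v(m, 1) = 0`, `g ≠ 0` a scale such that on `C = {(m,a) : m ≥ 3, a ≡ 1 (4), 1 < a < 2ᵐ}` the rational numbers
`([a/2ᵐ]⁺_f − [1/2ᵐ]⁺_f)/g` are INTEGERS congruent to `v(m,a)/8` modulo `2ℤ₂` (this is (★-SymbC′)), and let `H ∈ Λ`, `red H ≠ 0`,
be such that for every `k`, eventually in `n`, the `k`-th Riemann sum of the Stevens smoothing `Sm_5^5` of the `C`-normalised measure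
`ν₈(a + 2ⁿℤ₂) = (v(n,a) − v(n−1, a mod 2ⁿ⁻¹))/8` (`n ≥ 4`, `a ≡ 1 (4)`; `0` otherwise) is within `2⁻¹` of `[T^k] ι H` (this is the
output of `starEisFin`). Then for every nonzero `L₀ ∈ Λ` with `ι L₀ = c·L₂(f, α)`:
**`X²·red(pfree L₀) = red((1+T))·red H`** in `𝔽₂⟦T⟧`.
PROOF: `g⁻¹·RS(Sm μ_f) − 2·RS(Sm ν₈) = 2·Σ_s D_s·C(s,k) + 32·g⁻¹μ_f(1)·C(2ⁿ, k+1)` with `‖D_s‖ ≤ 1/2` (§2) and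
`‖C(2ⁿ, k+1)‖₂ → 0`; `RS(Sm μ_f) → [T^k](Sm_F·L₂)` (`Sm μ_f` is a bounded distribution; lit's `distributionTransform_stevensSmoothing_five`);
hence `‖g⁻¹[T^k](Sm_F L₂) − 2[T^k]ιH‖ ≤ 1/4`, so `(2gc)⁻¹·Sm_Λ·L₀ = ιL₁` with `red L₁ = red H`; the primitive-scale transfer gives
`red(pfree(Sm_Λ L₀)) = red L₁`, and `pfree(Sm_Λ L₀) = Sm_Λ·pfree L₀` with `red Sm_Λ = X²·red((1+T)⁻¹)`.
[cite: MazurTateTeitelbaum1986Invent, §I.10–I.13] [cite: Stevens1982, §5.4 (PDF pp. 73–74)] -/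
theorem sq_X_mul_red_pfree_eq_of_cuspCongruence8 (hord : IsOrdinaryAt W 2) (hf : IsNewformOf W f)
    (v : ℕ → ℤ → ℚ) (hv1 : ∀ m : ℕ, v m 1 = 0) (g : ℚ) (hg : g ≠ 0)
    (hC : ∀ (m : ℕ) (a : ℤ), 3 ≤ m → a % 4 = 1 → 1 < a → a < 2 ^ m →
      ∃ n : ℤ, ratPlusSymbol f ((a : ℚ) / (2 ^ m : ℕ)) - ratPlusSymbol f (1 / (2 ^ m : ℕ)) = n * g ∧
        ‖(n : ℚ_[2]) - ((v m a / 8 : ℚ) : ℚ_[2])‖ ≤ 2⁻¹)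
    (H : IwasawaAlgebra 2)
    (hH : ∀ k : ℕ, ∀ᶠ n in atTop, ‖distributionRiemannSum (stevensSmoothing 5 (fun m b ↦
        if 4 ≤ m ∧ b.val % 4 = 1 then
          (((v m (b.val : ℤ) - v (m - 1) ((b.val % 2 ^ (m - 1) : ℕ) : ℤ)) / 8 : ℚ) : ℚ_[2])
        else 0)) k n - PowerSeries.coeff k (iwasawaToPowerSeries 2 H)‖ ≤ 2⁻¹)
    (hredH : red H ≠ 0)
    {c : ℚ} {L₀ : IwasawaAlgebra 2} (hL₀ : L₀ ≠ 0)
    (hι : iwasawaToPowerSeries 2 L₀ = PowerSeries.C (c : ℚ_[2]) * padicLFunction f (unitRoot W 2 : ℚ_[2])) :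
    PowerSeries.X ^ 2 * red (pfree L₀) = red (PowerSeries.binomialSeries ℤ_[2] (1 : ℤ_[2])) * red H := by
  set α : ℚ_[2] := (unitRoot W 2 : ℚ_[2]) with hα
  set μ := msdMeasure f α with hμ_def
  set ν : (n : ℕ) → ZMod (2 ^ n) → ℚ_[2] := fun m b ↦
    if 4 ≤ m ∧ b.val % 4 = 1 then
      (((v m (b.val : ℤ) - v (m - 1) ((b.val % 2 ^ (m - 1) : ℕ) : ℤ)) / 8 : ℚ) : ℚ_[2])
    else 0 with hν
  -- `c ≠ 0`
  have hc : (c : ℚ_[2]) ≠ 0 := by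
    intro h0
    apply hL₀
    apply iwasawaToPowerSeries_injective 2
    rw [hι, h0, map_zero, zero_mul, map_zero]
  -- the curve side: `Sm μ_f` is a bounded distribution with transform `Sm_F · L₂(f, α)`
  have hdist := msdMeasure_distribution_of_isNewformOf hord hf
  obtain ⟨C₀, hC₀⟩ := exists_norm_msdMeasure_le_of_isNewformOf hord hf
  have hC₀' : 0 ≤ C₀ := (norm_nonneg _).trans (hC₀ 0 0)
  set SmF : PowerSeries ℚ_[2] := PowerSeries.C (26 : ℚ_[2]) -
    PowerSeries.C (5 : ℚ_[2]) * PowerSeries.binomialSeries ℚ_[2] (1 : ℤ_[2]) -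
    PowerSeries.C (5 : ℚ_[2]) * PowerSeries.binomialSeries ℚ_[2] (-1 : ℤ_[2]) with hSmF
  set SmΛ : IwasawaAlgebra 2 := PowerSeries.C (26 : ℤ_[2]) -
    PowerSeries.C (5 : ℤ_[2]) * PowerSeries.binomialSeries ℤ_[2] (1 : ℤ_[2]) -
    PowerSeries.C (5 : ℤ_[2]) * PowerSeries.binomialSeries ℤ_[2] (-1 : ℤ_[2]) with hSmΛ
  have hιSm : iwasawaToPowerSeries 2 SmΛ = SmF := by
    rw [hSmΛ, hSmF, map_sub, map_sub, map_mul, map_mul, iwasawaToPowerSeries_binomialSeries,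
      iwasawaToPowerSeries_binomialSeries]
    unfold iwasawaToPowerSeries
    rw [PowerSeries.map_C, PowerSeries.map_C]
    simp only [map_ofNat]
  have hLSm : distributionTransform (stevensSmoothing 5 μ) = SmF * padicLFunction f α := by
    rw [hSmF, padicLFunction_eq_distributionTransform]
    exact distributionTransform_stevensSmoothing_five hdist hC₀
  have hRSf : ∀ k, Tendsto (distributionRiemannSum (stevensSmoothing 5 μ) k) atTop
      (𝓝 (PowerSeries.coeff k (SmF * padicLFunction f α))) := fun k ↦ by
    rw [← hLSm]
    exact tendsto_distributionRiemannSum (stevensSmoothing_distribution hdist)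
      (norm_stevensSmoothing_le hC₀) k
  have hgq : (g : ℚ_[2]) ≠ 0 := by exact_mod_cast hg
  have hμneg : ∀ (m : ℕ) (b : ZMod (2 ^ m)), μ m (-b) = μ m b := msdMeasure_neg f α
  -- the smoothed `v`-measure vanishes on the `η = −1` classes
  have hνnot : ∀ {m : ℕ} (b : ZMod (2 ^ m)), ¬ (4 ≤ m ∧ b.val % 4 = 1) → ν m b = 0 := fun {m} b h ↦ by
    simp only [hν, if_neg h]
  have hSmνneg : ∀ (n : ℕ) (s : ZMod (2 ^ n)), 2 ≤ n →
      stevensSmoothing 5 ν (n + 2) (-((cyclotomicGenerator 2 : ZMod (2 ^ (n + 2))) ^ s.val)) = 0 := by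
    intro n s hn
    set b := -((cyclotomicGenerator 2 : ZMod (2 ^ (n + 2))) ^ s.val) with hb
    have hb3 : b.val % 4 = 3 := val_neg_cyclotomicGenerator_pow_mod_four n s.val
    have h1 := (four_dvd_two_pow (by omega : 2 ≤ n + 2)).trans (dvd_val_mul_five (by omega : 3 ≤ n + 2) b)
    have h2 := (four_dvd_two_pow (by omega : 2 ≤ n + 2)).trans (dvd_val_mul_five_inv (by omega : 3 ≤ n + 2) b)
    rw [stevensSmoothing_five_apply, hνnot b (by omega), hνnot (b * _) (by omega), hνnot (b * _) (by omega)]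
    ring
  -- Step 1: `‖g⁻¹·[T^k](Sm_F L₂) − 2·[T^k]ιH‖ ≤ 1/4`
  have hkey : ∀ k : ℕ, ‖(g : ℚ_[2])⁻¹ * PowerSeries.coeff k (SmF * padicLFunction f α) -
      2 * PowerSeries.coeff k (iwasawaToPowerSeries 2 H)‖ ≤ 4⁻¹ := by
    intro k
    set hk := PowerSeries.coeff k (iwasawaToPowerSeries 2 H) with hhk
    set F : ℕ → ℚ_[2] := fun n ↦ (g : ℚ_[2])⁻¹ * distributionRiemannSum (stevensSmoothing 5 μ) k n - 2 * hk with hF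
    have hFt : Tendsto F atTop (𝓝 ((g : ℚ_[2])⁻¹ * PowerSeries.coeff k (SmF * padicLFunction f α) - 2 * hk)) :=
      ((hRSf k).const_mul _).sub tendsto_const_nhds
    refine le_of_tendsto hFt.norm ?_
    -- `B n = 32 g⁻¹ μ(1) C(2ⁿ, k+1) → 0`
    set B : ℕ → ℚ_[2] := fun n ↦ 32 * ((g : ℚ_[2])⁻¹ * μ (n + 2) 1) *
      (((2 ^ n).choose (k + 1) : ℕ) : ℚ_[2]) with hB
    have hBt : Tendsto B atTop (𝓝 0) := by
      refine squeeze_zero_norm (a := fun n ↦ (‖(32 : ℚ_[2])‖ * (‖(g : ℚ_[2])⁻¹‖ * C₀) *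
        ‖(k : ℚ_[2]) + 1‖⁻¹) * (2⁻¹ : ℝ) ^ n) (fun n ↦ ?_) ?_
      · calc ‖B n‖ = ‖(32 : ℚ_[2])‖ * (‖(g : ℚ_[2])⁻¹‖ * ‖μ (n + 2) 1‖) *
              ‖(((2 ^ n).choose (k + 1) : ℕ) : ℚ_[2])‖ := by
              simp only [hB, norm_mul]
          _ ≤ ‖(32 : ℚ_[2])‖ * (‖(g : ℚ_[2])⁻¹‖ * C₀) * ((2 : ℝ)⁻¹ ^ n * ‖(k : ℚ_[2]) + 1‖⁻¹) := by
              gcongr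
              · exact hC₀ _ _
              · exact norm_choose_two_pow_succ_le n k
          _ = _ := by ring
      · have h := (tendsto_pow_atTop_nhds_zero_of_lt_one (show (0 : ℝ) ≤ 2⁻¹ by norm_num)
          (show (2⁻¹ : ℝ) < 1 by norm_num)).const_mul
          (‖(32 : ℚ_[2])‖ * (‖(g : ℚ_[2])⁻¹‖ * C₀) * ‖(k : ℚ_[2]) + 1‖⁻¹)
        rwa [mul_zero] at h
    have hBev : ∀ᶠ n in atTop, ‖B n‖ ≤ 4⁻¹ := by
      have := (Metric.tendsto_nhds.mp hBt) 4⁻¹ (by norm_num)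
      exact this.mono fun n hn ↦ by rw [dist_zero_right] at hn; exact hn.le
    filter_upwards [hBev, hH k, eventually_ge_atTop 2] with n hBn hHn hn2
    -- the finite-level identity `g⁻¹RS(Sm μ) − 2RS(Sm ν) − B n = 2 Σ_s D_s C(s,k)`
    have hsumC : ∑ s : ZMod (2 ^ n), ((s.val.choose k : ℕ) : ℚ_[2]) =
        (((2 ^ n).choose (k + 1) : ℕ) : ℚ_[2]) := by
      rw [sum_zmod_val_eq_sum_range (2 ^ n) (fun i ↦ ((i.choose k : ℕ) : ℚ_[2])),
        ← sum_range_choose_eq_choose_succ, Nat.cast_sum]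
    have hzero : ∑ s : ZMod (2 ^ n), stevensSmoothing 5 ν (n + 2)
        (-((cyclotomicGenerator 2 : ZMod (2 ^ (n + 2))) ^ s.val)) * (s.val.choose k : ℚ_[2]) = 0 :=
      Finset.sum_eq_zero fun s _ ↦ by rw [hSmνneg n s hn2, zero_mul]
    have hexp : (g : ℚ_[2])⁻¹ * distributionRiemannSum (stevensSmoothing 5 μ) k n -
        2 * distributionRiemannSum (stevensSmoothing 5 ν) k n - B n =
        2 * ∑ s : ZMod (2 ^ n),
          ((g : ℚ_[2])⁻¹ * (stevensSmoothing 5 μ (n + 2) ((cyclotomicGenerator 2 : ZMod (2 ^ (n + 2))) ^ s.val) -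
              16 * μ (n + 2) 1) -
            stevensSmoothing 5 ν (n + 2) ((cyclotomicGenerator 2 : ZMod (2 ^ (n + 2))) ^ s.val)) *
          (s.val.choose k : ℚ_[2]) := by
      simp only [hB]
      rw [distributionRiemannSum_two_of_even (stevensSmoothing_neg hμneg) k n,
        distributionRiemannSum_two_eq_add (stevensSmoothing 5 ν) k n, hzero, add_zero, ← hsumC]
      simp only [Finset.mul_sum, ← Finset.sum_sub_distrib]
      exact Finset.sum_congr rfl fun s _ ↦ by ring
    have hsum : ‖∑ s : ZMod (2 ^ n),
          ((g : ℚ_[2])⁻¹ * (stevensSmoothing 5 μ (n + 2) ((cyclotomicGenerator 2 : ZMod (2 ^ (n + 2))) ^ s.val) -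
              16 * μ (n + 2) 1) -
            stevensSmoothing 5 ν (n + 2) ((cyclotomicGenerator 2 : ZMod (2 ^ (n + 2))) ^ s.val)) *
          (s.val.choose k : ℚ_[2])‖ ≤ 2⁻¹ := by
      refine IsUltrametricDist.norm_sum_le_of_forall_le_of_nonneg (by norm_num) fun s _ ↦ ?_
      rw [norm_mul]
      calc _ ≤ (2⁻¹ : ℝ) * 1 := by
            gcongr
            · exact norm_stevensSmoothing_msdMeasure_sub_le_half f hord v hv1 g hg hC hn2 _
                (val_cyclotomicGenerator_pow_mod_four n s.val)
            · exact norm_cast_choose_le_one _ _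
        _ = 2⁻¹ := mul_one _
    have h1 : ‖(g : ℚ_[2])⁻¹ * distributionRiemannSum (stevensSmoothing 5 μ) k n -
        2 * distributionRiemannSum (stevensSmoothing 5 ν) k n - B n‖ ≤ 4⁻¹ := by
      rw [hexp, norm_mul, TwoAdicTwistConverse.norm_two_padic_two]
      calc (2 : ℝ)⁻¹ * _ ≤ 2⁻¹ * 2⁻¹ := by gcongr
        _ = 4⁻¹ := by norm_num
    have h2 : ‖2 * distributionRiemannSum (stevensSmoothing 5 ν) k n - 2 * hk‖ ≤ 4⁻¹ := by
      rw [← mul_sub, norm_mul, TwoAdicTwistConverse.norm_two_padic_two]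
      calc (2 : ℝ)⁻¹ * _ ≤ 2⁻¹ * 2⁻¹ := by gcongr
        _ = 4⁻¹ := by norm_num
    have hid : F n = ((g : ℚ_[2])⁻¹ * distributionRiemannSum (stevensSmoothing 5 μ) k n -
        2 * distributionRiemannSum (stevensSmoothing 5 ν) k n - B n) + B n +
        (2 * distributionRiemannSum (stevensSmoothing 5 ν) k n - 2 * hk) := by
      simp only [hF]; ring
    show ‖F n‖ ≤ 4⁻¹
    rw [hid]
    exact norm_add_le_of_le_two (norm_add_le_of_le_two h1 hBn) h2
  -- Step 2: `Y = (2g)⁻¹·Sm_F·L₂(f)` is within `1/2` of `ιH`, hence integral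
  set Y : PowerSeries ℚ_[2] := PowerSeries.C ((2 : ℚ_[2])⁻¹ * (g : ℚ_[2])⁻¹) * (SmF * padicLFunction f α) with hY
  have hYk : ∀ k, PowerSeries.coeff k Y - PowerSeries.coeff k (iwasawaToPowerSeries 2 H) =
      (2 : ℚ_[2])⁻¹ * ((g : ℚ_[2])⁻¹ * PowerSeries.coeff k (SmF * padicLFunction f α) -
        2 * PowerSeries.coeff k (iwasawaToPowerSeries 2 H)) := by
    intro k
    have h2 : (2 : ℚ_[2]) ≠ 0 := two_ne_zero
    rw [hY, PowerSeries.coeff_C_mul, mul_sub, ← mul_assoc, ← mul_assoc, inv_mul_cancel₀ h2, one_mul, mul_assoc]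
  have hYH : ∀ k, ‖PowerSeries.coeff k Y - PowerSeries.coeff k (iwasawaToPowerSeries 2 H)‖ ≤ 2⁻¹ := by
    intro k
    rw [hYk, norm_mul, norm_inv, TwoAdicTwistConverse.norm_two_padic_two, inv_inv]
    calc (2 : ℝ) * _ ≤ 2 * 4⁻¹ := by gcongr; exact hkey k
      _ = 2⁻¹ := by norm_num
  have hY1 : ∀ k, ‖PowerSeries.coeff k Y‖ ≤ 1 := by
    intro k
    have h1 : ‖PowerSeries.coeff k (iwasawaToPowerSeries 2 H)‖ ≤ 1 := by
      rw [PowerSeries.coeff_map]; exact PadicInt.norm_le_one _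
    have : PowerSeries.coeff k Y = (PowerSeries.coeff k Y - PowerSeries.coeff k (iwasawaToPowerSeries 2 H)) +
        PowerSeries.coeff k (iwasawaToPowerSeries 2 H) := by ring
    rw [this]
    exact norm_add_le_of_le_two ((hYH k).trans (by norm_num)) h1
  obtain ⟨L₁, hL₁⟩ := (exists_iwasawaToPowerSeries_eq_iff_norm_coeff_le_one Y).mpr hY1
  -- Step 3: `red L₁ = red H`
  have hred1 : red L₁ = red H := by
    refine red_eq_red_of_norm_coeff_sub_lt_one fun k ↦ ?_
    have h := hYH k
    rw [← hL₁, PowerSeries.coeff_map, PowerSeries.coeff_map] at h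
    change ‖((PowerSeries.coeff k L₁ : ℤ_[2]) : ℚ_[2]) - ((PowerSeries.coeff k H : ℤ_[2]) : ℚ_[2])‖ ≤ 2⁻¹ at h
    rw [← PadicInt.coe_sub, PadicInt.padic_norm_e_of_padicInt] at h
    exact h.trans_lt (by norm_num)
  have hredL₁ : red L₁ ≠ 0 := by rw [hred1]; exact hredH
  -- Step 4: primitive-scale transfer for `L₀ · Sm_Λ`
  have hredSm : red SmΛ = PowerSeries.X ^ 2 * red (PowerSeries.binomialSeries ℤ_[2] (-1 : ℤ_[2])) :=
    red_smoothingElement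
  have hredSm0 : red SmΛ ≠ 0 := by
    rw [hredSm]
    refine mul_ne_zero (pow_ne_zero _ PowerSeries.X_ne_zero) fun h ↦ ?_
    have := order_red_binomialSeries (-1 : ℤ_[2])
    rw [h, PowerSeries.order_zero] at this
    exact ENat.top_ne_zero this
  have hSm0 : SmΛ ≠ 0 := fun h ↦ hredSm0 (by rw [h]; unfold red; rw [map_zero])
  have hprod0 : L₀ * SmΛ ≠ 0 := mul_ne_zero hL₀ hSm0
  have hι₀ : iwasawaToPowerSeries 2 (L₀ * SmΛ) =
      PowerSeries.C (1 : ℚ_[2]) * iwasawaToPowerSeries 2 (L₀ * SmΛ) := by rw [map_one, one_mul]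
  have hι₁ : iwasawaToPowerSeries 2 L₁ =
      PowerSeries.C ((2 : ℚ_[2])⁻¹ * (g : ℚ_[2])⁻¹ * (c : ℚ_[2])⁻¹) * iwasawaToPowerSeries 2 (L₀ * SmΛ) := by
    rw [hL₁, hY, (iwasawaToPowerSeries 2).map_mul L₀ SmΛ, hι, hιSm,
      show PowerSeries.C ((2 : ℚ_[2])⁻¹ * (g : ℚ_[2])⁻¹ * (c : ℚ_[2])⁻¹) =
        PowerSeries.C ((2 : ℚ_[2])⁻¹ * (g : ℚ_[2])⁻¹) * PowerSeries.C ((c : ℚ_[2])⁻¹) from map_mul _ _ _]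
    have : PowerSeries.C ((c : ℚ_[2])⁻¹) * PowerSeries.C (c : ℚ_[2]) = 1 := by
      rw [← map_mul, inv_mul_cancel₀ hc, map_one]
    linear_combination (-(PowerSeries.C ((2 : ℚ_[2])⁻¹ * (g : ℚ_[2])⁻¹) * SmF * padicLFunction f α)) * this
  have htransfer := red_pfree_eq_red_two hprod0 hι₀ hι₁ hredL₁
  rw [pfree_mul_of_red_ne_zero hL₀ hredSm0, red_mul', hred1, hredSm] at htransfer
  -- Step 5: multiply by `red((1+T))`
  have hunit : red (PowerSeries.binomialSeries ℤ_[2] (1 : ℤ_[2])) *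
      red (PowerSeries.binomialSeries ℤ_[2] (-1 : ℤ_[2])) = 1 := by
    rw [← red_mul', ← PowerSeries.binomialSeries_add, add_neg_cancel, PowerSeries.binomialSeries_zero]
    unfold red; rw [map_one]
  calc PowerSeries.X ^ 2 * red (pfree L₀)
      = red (PowerSeries.binomialSeries ℤ_[2] (1 : ℤ_[2])) *
          (red (pfree L₀) * (PowerSeries.X ^ 2 * red (PowerSeries.binomialSeries ℤ_[2] (-1 : ℤ_[2])))) := by
        linear_combination (-(PowerSeries.X ^ 2 * red (pfree L₀))) * hunit
    _ = red (PowerSeries.binomialSeries ℤ_[2] (1 : ℤ_[2])) * red H := by rw [htransfer]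

end GlueFin

end Summit.BirchSwinnertonDyer.BirchSwinnertonDyer.Theorems.DepletionAtTwo

end
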